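import Summits.QuantumFields.BalabanUV.Beta.GAN24.CovariantCurveTaylorAtBase
import Summits.QuantumFields.BalabanUV.Beta.GAN24.ExponentialChartBaseBackgrounds
import Summits.QuantumFields.BalabanUV.Beta.GAN24.ExponentialChartCovariantTaylor

/-!
# `BalabanUV.Beta.GAN24.ExponentialChartBaseCovariantTaylorLine` — binder row G-an2-4 ∕ (CONV-C), route R7 «TWO CURRENCIES», leaf lane (η′) «THE ONE-PARAMETER TOWER AT THE BASE POINT»,
# PART 2∕2: PART 247 AT A BASE POINT.  Along Bałaban's chart `U_s = exp(iη(A₀ + sX))` at a NONZERO SMALL REAL BASE CONNECTION `A₀` (`U₀ = e^{iηA₀}`) and a real Lipschitz direction `X`,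
# EVERY s-derivative at `s = 0` of the inverse effective covariance `(L^{dk}Q_k(Δ_a^{(k)} + (Δ^{U_s,(k)} − Δ^{1,(k)}))⁻¹Q_kᴴ)⁻¹` has the β-cell's whole `LimitRate` END on `ℤ^d`, displaying ONLY
# `(α, β)` + EL₁ of `X_t`, the constants `(α₀, β₀)` ∕ `(α₀′, β₀′)` of the base connection `−w₀,t = connV U₀,t` and of `z₀,t = zT U₀,t` on the three-condition disc at coupling `1`, and EL₁ of
# `−w₀,t` (PART 269's display minus EL₁ of `z₀,t`, which is not needed; PART 247 is `A₀ = 0`).  PART 1∕2 (`CovariantCurveTaylorAtBase` §2: any smooth transporter curve through a small base transporter — PART 240's diagrams in the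
# PERTURBED propagator `(Δ_a + (Δ^{U₀} − Δ^1))⁻¹` + PART 264) with its displayed jet hypotheses DISCHARGED: the jets at `s = 0` are PART 265 §3's closed forms — PART 245∕246's jets
# TWISTED BY THE BASE PHASES `e^{±θ₀}` — and they are Lipschitz ∕ bounded backgrounds by PART 246 (`lipschitzBackground_expJetV`) × PART 267 (`lipschitzBackground_basePhase ∕
# _baseConjPhase`, `lipschitzBackground_mul`, `boundedBackground_sum_mul`, `boundedBackground_baseJetZ`); their EL₁ is EL₁ of `X_t` and of `e^{±θ₀,t} = 1 − V₀,t∕n`, `1 − V̄₀,t∕n`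
# (unit b2b-balaban-gan24-formalise-leaf-01, gen 94; v1; road-P3 g67's cut (η′), journal l.68353)

NOT IN PRINT; OUR PROOF ([folklore] bookkeeping BY NAME over PART 1∕2 (`conv_iteratedDeriv_invCov_covariantCurveAt_of_tendsto`), PART 265 (`iteratedDeriv_connV_expChartAt`,
`iteratedDeriv_zT_expChartAt`, `cexp_add_mul_eq`), PART 267 (`lipschitzBackground_mul`, `boundedBackground_sum_mul`, `lipschitzBackground_basePhase ∕ _baseConjPhase ∕ _I_mul`,
`boundedBackground_baseJetZ`, `basePhase_eq`, `baseConjPhase_eq`), PART 253 (`lipschitzBackground_mono ∕ _const_mul`, `boundedBackground_mono ∕ _add`), PART 246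
(`lipschitzBackground_expJetV`, `natCast_mul_div_pow_succ`, `natCast_sq_mul_div_pow`), PART 245 (`contDiff_expChart_entry`); [Balaban1985BackgroundPropagators] (3.3) p. 390, (3.35) p. 396
and [Balaban1987RG1] (1.20)–(1.22) p. 264 LOCATE the shapes; nothing printed is a hypothesis).
HONEST FRAMING (cell contract, verbatim): «discharging `BetaPertH` makes Bałaban's UV stability UNCONDITIONAL — a real constructive-QFT result; it is NOT the
continuum limit and NOT the Clay problem.»  HONEST DEPENDENCY (verbatim): «continuum YM on T⁴ ⇐ BetaPertH ∧ nine spine estimates (0/9 proved); BetaPertH ⇐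
(D1) ∧ (D4) ∧ CAP+tail; G-an2-4 gates asym, D1 and NE2/3/4.»

WHAT THIS FILE PROVES (0 sorry, 0 `def`; `U_s k ν x = exp(I·A₀ k ν x∕n_k + (I·X k ν x∕n_k)·s)`, `A₀, X` REAL, every volume `M`):
* §1 (the jets in product shapes) `expChartAt_jetV_succ` (`−(iX)^{i+1}∕n^i · e^{θ₀}`), `expChartAt_jetZ_one` (`−nΣ_ν(iX_ν)(e^{θ₀,ν} − e^{−θ₀,ν})`), `expChartAt_jetZ_succ_succ`
  (`Σ_ν[−(iX_ν)^{i+1}∕n^i·(iX_ν)]e^{θ₀,ν} + Σ_ν[−(i(−X_ν))^{i+1}∕n^i·(i(−X_ν))]e^{−θ₀,ν}`), `lipschitzBackground_ofReal_neg`.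
* §2 (backgrounds) **`lipschitzBackground_expChartAt_jetV_succ`**, **`boundedBackground_expChartAt_jetZ_one`**, **`boundedBackground_expChartAt_jetZ_succ_succ`**.
* §3 **`conv_iteratedDeriv_invCov_expChartAt_of_tendsto`** (`d ≥ 3`, `L ≥ 2`, `a > 0`, `μ ≠ ν`, even cubic volumes, every order `N`): THE END at the base point, displaying only `(α, β)` + EL₁ of
  `X_t`, `(α₀, β₀)` ∕ `(α₀′, β₀′)` of `connV U₀,t` ∕ `zT U₀,t`, EL₁ of `connV U₀,t`, the three CT-disc conditions and the three smallness conditions at coupling `1`.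
WHAT IT DOES NOT DO: the `N = 2` object as explicit diagrams (`ExponentialChartBaseTower`, PART 256 at the base); several parameters (PARTs 268∕269); base connections outside the disc;
colour; Bałaban's `−∂P∂*` ∕ `aQ(U)*Q(U)` parts.  SUPPLIER work; NEVER «G-an2-4 closed»; NOT (CONV-C), NOT D1, NOT `BetaPertH`, NOT continuum, NOT Clay.
Records: `HOME/b2b-balaban-gan24-formalise-leaf-01/g94/README-g94.md`.
-/

noncomputable section

open scoped BigOperators ComplexConjugate Matrix Matrix.Norms.L2Operator
open Filter Topology

namespace Summit.QuantumFields.BalabanUV.Beta.GAN24.ExponentialChartBaseCovariantTaylorLine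

open Literature.MathematicalPhysics.QuantumFieldTheory.Balaban1983to89
open Literature.MathematicalPhysics.QuantumFieldTheory.Balaban1983to89.B5Prop11Plancherel (Tor fine Cst)
open Literature.MathematicalPhysics.QuantumFieldTheory.Balaban1983to89.B5G183RateUnitTower (lev)
open Literature.MathematicalPhysics.QuantumFieldTheory.Balaban1983to89.B12Sec2to5 (betaPrime510)
open Literature.MathematicalPhysics.QuantumFieldTheory.Balaban1983to89.Beta (Site IsInfiniteVolumeLimit)
open Literature.MathematicalPhysics.QuantumFieldTheory.Balaban1983to89.Beta.FreeLegDictionary (cubic)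
open Literature.MathematicalPhysics.QuantumFieldTheory.Balaban1983to89.Beta.BlockKernelVolumeSockets (evenPeriod)
open Literature.MathematicalPhysics.QuantumFieldTheory.Balaban1983to89.Beta.VectorTails (castT)
open Literature.MathematicalPhysics.QuantumFieldTheory.Balaban1983to89.Beta.LimitRate (StepRate limKernelOf KernelInputs)
open Summit.QuantumFields.BalabanUV.T4Continuum
open Summit.QuantumFields.BalabanUV.T4Continuum.CovariantAveragingTower (avgTow)
open Summit.QuantumFields.BalabanUV.T4Continuum.BalabanAveragedTowerUnit (idx QBlev)
open Summit.QuantumFields.BalabanUV.T4Continuum.BalabanAveragedCoerciveTower (unitIdx)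
open Summit.QuantumFields.BalabanUV.T4Continuum.BalabanAveragedCoercive (gammaB)
open Summit.QuantumFields.BalabanUV.T4Continuum.KingPairingPlantedLaw (calDalev)
open Summit.QuantumFields.BalabanUV.T4Continuum.FirstOrderBackgroundModel (LipschitzBackground)
open Summit.QuantumFields.BalabanUV.T4Continuum.PerturbationAlgebra (BoundedBackground)
open Summit.QuantumFields.BalabanUV.T4Continuum.AbelianCovariantLaplacian (covPert connV zT)
open Summit.QuantumFields.BalabanUV.T4Continuum.CTConjugatedHbd (G2)
open Summit.QuantumFields.BalabanUV.T4Continuum.DirichletRegionTower (gamD)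
open Summit.QuantumFields.BalabanUV.T4Continuum.ScalarAveragedPropagator (gammaPs)
open Summit.QuantumFields.BalabanUV.T4Continuum.ScalarAveragedCompression (sigma0)
open Summit.QuantumFields.BalabanUV.T4Continuum.CTScalarGreen (Jfree)
open Summit.QuantumFields.BalabanUV.T4Continuum.CTGaugeTerm (deltaK)
open Summit.QuantumFields.BalabanUV.T4Continuum.CTVectorPropagator (JA)
open Summit.QuantumFields.BalabanUV.Beta.GAN24.ExponentialChartJets (contDiff_expChart_entry)
open Summit.QuantumFields.BalabanUV.Beta.GAN24.ExponentialChartBackgrounds (natCast_mul_div_pow_succ natCast_sq_mul_div_pow lipschitzBackground_expJetV)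
open Summit.QuantumFields.BalabanUV.Beta.GAN24.ExponentialChartMixedBackgrounds (lipschitzBackground_mono lipschitzBackground_const_mul boundedBackground_mono boundedBackground_add)
open Summit.QuantumFields.BalabanUV.Beta.GAN24.ExponentialChartBaseJets (iteratedDeriv_connV_expChartAt iteratedDeriv_zT_expChartAt cexp_add_mul_eq)
open Summit.QuantumFields.BalabanUV.Beta.GAN24.ExponentialChartBaseBackgrounds (lipschitzBackground_mul boundedBackground_sum_mul lipschitzBackground_basePhase
  lipschitzBackground_baseConjPhase lipschitzBackground_I_mul boundedBackground_baseJetZ basePhase_eq baseConjPhase_eq)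
open Summit.QuantumFields.BalabanUV.Beta.GAN24.CovariantCurveTaylorAtBase (conv_iteratedDeriv_invCov_covariantCurveAt_of_tendsto)

variable {d : ℕ} (L : ℕ) [NeZero L]

/-! ## §1 The jets of the chart at the base point in product shapes -/

section Jets

variable (M : Fin d → ℕ) [hM : ∀ μ, NeZero (M μ)]

omit hM in
/-- the `(i+1)`-st connection jet at the base point: `−(iX)^{i+1}∕n^i · e^{θ₀}` (PART 265's `−n·e^{θ₀}·(iX∕n)^{i+1}`). [folklore] -/
theorem expChartAt_jetV_succ (A₀ X : (k : ℕ) → Fin d → (idx L M k → ℝ)) (i : ℕ) :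
    (fun k ν x => iteratedDeriv (i + 1) (fun s : ℝ => connV L M (fun k' ν' x' => Complex.exp (Complex.I * (A₀ k' ν' x' : ℂ) / ((lev L k' : ℕ) : ℂ)
        + (Complex.I * (X k' ν' x' : ℂ) / ((lev L k' : ℕ) : ℂ)) * (s : ℂ))) k ν x) 0)
      = fun k ν x => -((Complex.I * (X k ν x : ℂ)) ^ (i + 1) / ((lev L k : ℕ) : ℂ) ^ i) * Complex.exp (Complex.I * (A₀ k ν x : ℂ) / ((lev L k : ℕ) : ℂ)) := by
  funext k ν x
  rw [iteratedDeriv_connV_expChartAt, if_neg (Nat.succ_ne_zero i), ← natCast_mul_div_pow_succ (NeZero.ne (lev L k)) (Complex.I * (X k ν x : ℂ)) i]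
  ring

omit hM in
/-- the first zeroth-order jet at the base point: `−n²Σ_ν(e^{θ₀,ν}(iX_ν∕n) + e^{−θ₀,ν}(−iX_ν∕n)) = −nΣ_ν(iX_ν)(e^{θ₀,ν} − e^{−θ₀,ν})` (PART 267's shape; NONZERO unless `A₀ = 0`). [folklore] -/
theorem expChartAt_jetZ_one (A₀ X : (k : ℕ) → Fin d → (idx L M k → ℝ)) :
    (fun k x => iteratedDeriv 1 (fun s : ℝ => zT L M (fun k' ν' x' => Complex.exp (Complex.I * (A₀ k' ν' x' : ℂ) / ((lev L k' : ℕ) : ℂ)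
        + (Complex.I * (X k' ν' x' : ℂ) / ((lev L k' : ℕ) : ℂ)) * (s : ℂ))) k x) 0)
      = fun k x => -((lev L k : ℕ) : ℂ) * ∑ ν, (Complex.I * (X k ν x : ℂ))
          * (Complex.exp (Complex.I * (A₀ k ν x : ℂ) / ((lev L k : ℕ) : ℂ)) - Complex.exp (-(Complex.I * (A₀ k ν x : ℂ) / ((lev L k : ℕ) : ℂ)))) := by
  funext k x
  have hn : ((lev L k : ℕ) : ℂ) ≠ 0 := by exact_mod_cast NeZero.ne (lev L k)
  rw [iteratedDeriv_zT_expChartAt, if_neg one_ne_zero, Finset.mul_sum, Finset.mul_sum]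
  refine Finset.sum_congr rfl fun ν _ => ?_
  rw [pow_one, pow_one]
  field_simp
  ring

omit hM in
/-- the `(i+2)`-nd zeroth-order jet at the base point in product shape: `−n²Σ_ν(e^{θ₀,ν}(iX_ν∕n)^{i+2} + e^{−θ₀,ν}(−iX_ν∕n)^{i+2})
= Σ_ν[−(iX_ν)^{i+1}∕n^i · (iX_ν)]·e^{θ₀,ν} + Σ_ν[−(i(−X_ν))^{i+1}∕n^i · (i(−X_ν))]·e^{−θ₀,ν}` (PART 246's jet shapes for `X` and `−X`, times the base phases). [folklore] -/
theorem expChartAt_jetZ_succ_succ (A₀ X : (k : ℕ) → Fin d → (idx L M k → ℝ)) (i : ℕ) :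
    (fun k x => iteratedDeriv (i + 2) (fun s : ℝ => zT L M (fun k' ν' x' => Complex.exp (Complex.I * (A₀ k' ν' x' : ℂ) / ((lev L k' : ℕ) : ℂ)
        + (Complex.I * (X k' ν' x' : ℂ) / ((lev L k' : ℕ) : ℂ)) * (s : ℂ))) k x) 0)
      = fun k x => (∑ ν, (-((Complex.I * (X k ν x : ℂ)) ^ (i + 1) / ((lev L k : ℕ) : ℂ) ^ i) * (Complex.I * (X k ν x : ℂ)))
            * Complex.exp (Complex.I * (A₀ k ν x : ℂ) / ((lev L k : ℕ) : ℂ)))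
          + (∑ ν, (-((Complex.I * ((-X k ν x : ℝ) : ℂ)) ^ (i + 1) / ((lev L k : ℕ) : ℂ) ^ i) * (Complex.I * ((-X k ν x : ℝ) : ℂ)))
            * Complex.exp (-(Complex.I * (A₀ k ν x : ℂ) / ((lev L k : ℕ) : ℂ)))) := by
  funext k x
  have hn : (lev L k : ℕ) ≠ 0 := NeZero.ne (lev L k)
  rw [iteratedDeriv_zT_expChartAt, if_neg (by omega : i + 2 ≠ 0), Finset.mul_sum, ← Finset.sum_add_distrib]
  refine Finset.sum_congr rfl fun ν _ => ?_
  have h1 := natCast_sq_mul_div_pow hn (Complex.I * (X k ν x : ℂ)) i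
  have h2 := natCast_sq_mul_div_pow hn (-(Complex.I * (X k ν x : ℂ))) i
  rw [neg_div] at h2
  push_cast
  linear_combination (-Complex.exp (Complex.I * (A₀ k ν x : ℂ) / ((lev L k : ℕ) : ℂ))) * h1
    + (-Complex.exp (-(Complex.I * (A₀ k ν x : ℂ) / ((lev L k : ℕ) : ℂ)))) * h2

omit [NeZero L] hM in
/-- `−X` is a real Lipschitz background with the constants of `X`. [folklore] -/
theorem lipschitzBackground_ofReal_neg {X : (k : ℕ) → Fin d → (idx L M k → ℝ)} {α β : ℝ} (hX : LipschitzBackground L M (fun k ν x => (X k ν x : ℂ)) α β) :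
    LipschitzBackground L M (fun k ν x => ((-X k ν x : ℝ) : ℂ)) α β := by
  have h := lipschitzBackground_const_mul L M hX (-1)
  rw [norm_neg, norm_one, one_mul, one_mul] at h
  have e : (fun k ν (x : idx L M k) => (-1 : ℂ) * (X k ν x : ℂ)) = fun k ν x => ((-X k ν x : ℝ) : ℂ) := by
    funext k ν x; push_cast; ring
  rw [e] at h
  exact h

end Jets

/-! ## §2 The jets at the base point are Lipschitz ∕ bounded backgrounds (PART 246 × PART 267) -/

section Backgrounds

variable (M : Fin d → ℕ) [hM : ∀ μ, NeZero (M μ)]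

omit hM in
/-- **`lipschitzBackground_expChartAt_jetV_succ`** — for `i + 1 ≤ N` the `(i+1)`-st connection jet at the base point is Lipschitz
`((1+α)^N(1+α₀), (1+α)^N(α₀+β₀) + (1+α)^N((N+1)β+2)(1+α₀))` (PART 246's jet `((1+α)^N, (1+α)^N((N+1)β+2))` × PART 267's base phase `(1+α₀, α₀+β₀)`). [folklore] -/
theorem lipschitzBackground_expChartAt_jetV_succ {A₀ X : (k : ℕ) → Fin d → (idx L M k → ℝ)} {α β α₀ β₀ : ℝ}
    (hX : LipschitzBackground L M (fun k ν x => (X k ν x : ℂ)) α β)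
    (hw : LipschitzBackground L M (connV L M (fun k ν x => Complex.exp (Complex.I * (A₀ k ν x : ℂ) / ((lev L k : ℕ) : ℂ)))) α₀ β₀) {N i : ℕ} (hi : i + 1 ≤ N) :
    LipschitzBackground L M (fun k ν x => iteratedDeriv (i + 1) (fun s : ℝ => connV L M (fun k' ν' x' => Complex.exp (Complex.I * (A₀ k' ν' x' : ℂ) / ((lev L k' : ℕ) : ℂ)
        + (Complex.I * (X k' ν' x' : ℂ) / ((lev L k' : ℕ) : ℂ)) * (s : ℂ))) k ν x) 0)
      ((1 + α) ^ N * (1 + α₀)) ((1 + α) ^ N * (α₀ + β₀) + (1 + α) ^ N * ((N + 1) * β + 2) * (1 + α₀)) := by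
  rw [expChartAt_jetV_succ]
  exact lipschitzBackground_mul L M (lipschitzBackground_expJetV L M hX hi) (lipschitzBackground_basePhase L M hw)

omit hM in
/-- **`boundedBackground_expChartAt_jetZ_one`** — the first zeroth-order jet at the base point is a bounded background `(d·α·2α₀, d(α·2β₀ + β·2α₀))` (PART 267's `boundedBackground_baseJetZ`).
[folklore] -/
theorem boundedBackground_expChartAt_jetZ_one {A₀ X : (k : ℕ) → Fin d → (idx L M k → ℝ)} {α β α₀ β₀ : ℝ}
    (hX : LipschitzBackground L M (fun k ν x => (X k ν x : ℂ)) α β)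
    (hw : LipschitzBackground L M (connV L M (fun k ν x => Complex.exp (Complex.I * (A₀ k ν x : ℂ) / ((lev L k : ℕ) : ℂ)))) α₀ β₀) :
    BoundedBackground L M (fun k x => iteratedDeriv 1 (fun s : ℝ => zT L M (fun k' ν' x' => Complex.exp (Complex.I * (A₀ k' ν' x' : ℂ) / ((lev L k' : ℕ) : ℂ)
        + (Complex.I * (X k' ν' x' : ℂ) / ((lev L k' : ℕ) : ℂ)) * (s : ℂ))) k x) 0)
      (d * (α * (α₀ + α₀))) (d * (α * (β₀ + β₀) + β * (α₀ + α₀))) := by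
  rw [expChartAt_jetZ_one]
  exact boundedBackground_baseJetZ L M hX hw

omit hM in
/-- **`boundedBackground_expChartAt_jetZ_succ_succ`** — for `i + 2 ≤ N` the `(i+2)`-nd zeroth-order jet at the base point is a bounded background: twice PART 267's direction sum of
(PART 246's jet × `iX`) × base phase. [folklore] -/
theorem boundedBackground_expChartAt_jetZ_succ_succ {A₀ X : (k : ℕ) → Fin d → (idx L M k → ℝ)} {α β α₀ β₀ : ℝ}
    (hX : LipschitzBackground L M (fun k ν x => (X k ν x : ℂ)) α β)
    (hw : LipschitzBackground L M (connV L M (fun k ν x => Complex.exp (Complex.I * (A₀ k ν x : ℂ) / ((lev L k : ℕ) : ℂ)))) α₀ β₀) {N i : ℕ} (hi : i + 2 ≤ N) :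
    BoundedBackground L M (fun k x => iteratedDeriv (i + 2) (fun s : ℝ => zT L M (fun k' ν' x' => Complex.exp (Complex.I * (A₀ k' ν' x' : ℂ) / ((lev L k' : ℕ) : ℂ)
        + (Complex.I * (X k' ν' x' : ℂ) / ((lev L k' : ℕ) : ℂ)) * (s : ℂ))) k x) 0)
      (d * ((1 + α) ^ N * α * (1 + α₀)) + d * ((1 + α) ^ N * α * (1 + α₀)))
      (d * ((1 + α) ^ N * α * (α₀ + β₀) + ((1 + α) ^ N * β + (1 + α) ^ N * ((N + 1) * β + 2) * α) * (1 + α₀))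
        + d * ((1 + α) ^ N * α * (α₀ + β₀) + ((1 + α) ^ N * β + (1 + α) ^ N * ((N + 1) * β + 2) * α) * (1 + α₀))) := by
  have hi' : i + 1 ≤ N := by omega
  rw [expChartAt_jetZ_succ_succ]
  exact boundedBackground_add L M
    (boundedBackground_sum_mul L M (lipschitzBackground_mul L M (lipschitzBackground_expJetV L M hX hi') (lipschitzBackground_I_mul L M hX))
      (lipschitzBackground_basePhase L M hw))
    (boundedBackground_sum_mul L M (lipschitzBackground_mul L M (lipschitzBackground_expJetV L M (lipschitzBackground_ofReal_neg L M hX) hi')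
      (lipschitzBackground_I_mul L M (lipschitzBackground_ofReal_neg L M hX))) (lipschitzBackground_baseConjPhase L M hw))

end Backgrounds

/-! ## §3 THE END at the base point, displaying only `(α, β)` + EL₁ of `X` and the base constants ∕ EL₁ -/

section End

variable (a : ℝ) (ha : 0 < a)

/-- **`conv_iteratedDeriv_invCov_expChartAt_of_tendsto` — THE EXACT ABELIAN COVARIANT VECTOR LAPLACIAN IN BAŁABAN's CHART `U_s = exp(iη(A₀ + sX))` AT A NONZERO SMALL REAL BASE CONNECTION:
EVERY s-DERIVATIVE AT `s = 0` OF THE INVERSE EFFECTIVE COVARIANCE HAS THE β-CELL's WHOLE `LimitRate` END ON `ℤ^d`** [our proof] (`d ≥ 3`, `L ≥ 2`, `a > 0`, `μ ≠ ν`, even cubic volumes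
`2(t+1)`, every order `N`).  Displayed: `(α, β)` + EL₁ of the real directions `X_t`; `(α₀, β₀)` of `−w₀,t = connV U₀,t` and `(α₀′, β₀′)` of `z₀,t = zT U₀,t` with their EL₁, on PART 264's
three-condition disc at coupling `1` (`hγ' hδ' hJA`, `hT₁ hT₂ hT₃`); NO EL₁ hypothesis on `z₀,t` (its jets' limits follow from those of `e^{±θ₀,t}`).  PART 1∕2 §2 with its jet hypotheses DISCHARGED by §2 (common constants by `max`) and EL₁ of the jets from EL₁ of `X_t` and of
`e^{±θ₀,t}` (`basePhase_eq`, `baseConjPhase_eq`).  PART 247 is `A₀ = 0`; the words of the expansion carry the PERTURBED propagator `(Δ_a + (Δ^{U₀} − Δ^1))⁻¹` and `E₀ = c_k(U₀)⁻¹`.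
[cite: Balaban1985BackgroundPropagators, (3.3) p.390, (3.35) p.396 (shapes); Balaban1987RG1, (1.20)–(1.22) p.264 (shapes)] -/
theorem conv_iteratedDeriv_invCov_expChartAt_of_tendsto (hL : 2 ≤ L) (hd : 3 ≤ d) {μ ν : Fin d} (hne : μ ≠ ν)
    {α₀ β₀ α₀' β₀' α β a' κ : ℝ} (ha' : 0 < a') (hκ0 : 0 < κ)
    (hγ' : Jfree d a' κ 1 < gammaPs d a') (hδ' : deltaK d a' κ 1 < sigma0 d a' ^ 2) (hJA : JA d a a' κ 1 < gamD d a)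
    (hT₁ : 1 * (2 * (d * (α₀ + β₀) * Cst d a) + α₀' * Cst d a) ≤ 1 / 2)
    (hT₂ : 1 * (d * (α₀ * G2 d a (max (JA d a a' κ 1) 0) (gamD d a - max (JA d a a' κ 1) 0) κ)
      + d * (Real.exp |κ| * (α₀ * G2 d a (max (JA d a a' κ 1) 0) (gamD d a - max (JA d a a' κ 1) 0) κ + β₀ * (gamD d a - max (JA d a a' κ 1) 0)⁻¹))
      + α₀' * (gamD d a - max (JA d a a' κ 1) 0)⁻¹) ≤ 1 / 2)
    (hT₃ : 4 * 1 * (2 * (d * (α₀ + β₀) * Cst d a) + α₀' * Cst d a) * Cst d a ≤ gammaB d a) (N : ℕ)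
    {A₀ X : (t : ℕ) → (k : ℕ) → Fin d → (idx L (cubic d (evenPeriod t)) k → ℝ)}
    (hX : ∀ t, LipschitzBackground L (cubic d (evenPeriod t)) (fun k ν' x => (X t k ν' x : ℂ)) α β)
    (hw : ∀ t, LipschitzBackground L (cubic d (evenPeriod t)) (connV L (cubic d (evenPeriod t))
      (fun k ν' (x : idx L (cubic d (evenPeriod t)) k) => Complex.exp (Complex.I * (A₀ t k ν' x : ℂ) / ((lev L k : ℕ) : ℂ)))) α₀ β₀)
    (hz : ∀ t, BoundedBackground L (cubic d (evenPeriod t)) (zT L (cubic d (evenPeriod t))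
      (fun k ν' (x : idx L (cubic d (evenPeriod t)) k) => Complex.exp (Complex.I * (A₀ t k ν' x : ℂ) / ((lev L k : ℕ) : ℂ)))) α₀' β₀')
    (hX1 : ∀ k (ν' f : Fin d) (z : Fin d → ℤ), ∃ s' : ℂ, Tendsto (fun t => ((X t k ν' (castT (cubic d (lev L k * evenPeriod t)) z, f) : ℝ) : ℂ)) atTop (𝓝 s'))
    (hw1 : ∀ k (ν' f : Fin d) (z : Fin d → ℤ), ∃ s' : ℂ, Tendsto (fun t => connV L (cubic d (evenPeriod t))
      (fun k'' ν'' (x' : idx L (cubic d (evenPeriod t)) k'') => Complex.exp (Complex.I * (A₀ t k'' ν'' x' : ℂ) / ((lev L k'' : ℕ) : ℂ)))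
      k ν' (castT (cubic d (lev L k * evenPeriod t)) z, f)) atTop (𝓝 s')) :
    ∃ κ₁ B₀ B' : ℝ, 0 < κ₁ ∧ 0 ≤ B₀ ∧ 0 ≤ B' ∧ ∃ Pinf : ℕ → B12Beta.Kernel d,
      (∀ k, IsInfiniteVolumeLimit evenPeriod
        (fun t μ' ν' (z : Site d (evenPeriod t)) =>
          ((iteratedDeriv N (fun s : ℝ => (avgTow (QBlev L (cubic d (evenPeriod t))) ((L : ℝ) ^ d)
              (fun k' => (calDalev L (cubic d (evenPeriod t)) a ha k'
                + covPert L (cubic d (evenPeriod t)) (fun k'' ν'' x => Complex.exp (Complex.I * (A₀ t k'' ν'' x : ℂ) / ((lev L k'' : ℕ) : ℂ)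
                  + (Complex.I * (X t k'' ν'' x : ℂ) / ((lev L k'' : ℕ) : ℂ)) * (s : ℂ))) k')⁻¹) k)⁻¹) 0)
            ((unitIdx L (cubic d (evenPeriod t))).symm (z, μ')) ((unitIdx L (cubic d (evenPeriod t))).symm (0, ν'))).re) (Pinf k)) ∧
      Beta.LimitRate.UniformDecay Pinf μ ν B₀ (κ₁ / d) ∧ StepRate Pinf μ ν B' (κ₁ / d) (Real.sqrt ((L : ℝ)⁻¹)) ∧
      (∃ K : KernelInputs d Pinf, K.θ = Real.sqrt ((L : ℝ)⁻¹) ∧ K.c₀ = betaPrime510 d (B' / (1 - Real.sqrt ((L : ℝ)⁻¹))) (κ₁ / d) ∧ K.Pinf = limKernelOf Pinf ∧ K.μ = μ ∧ K.ν = ν) ∧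
      (∀ k, |B12Beta.secondMoment (Pinf k) μ ν - B12Beta.secondMoment (limKernelOf Pinf) μ ν|
          ≤ betaPrime510 d (B' / (1 - Real.sqrt ((L : ℝ)⁻¹))) (κ₁ / d) * Real.sqrt ((L : ℝ)⁻¹) ^ k) := by
  have hα : 0 ≤ α := (hX 0).nonneg.1
  have hβ : 0 ≤ β := (hX 0).nonneg.2
  have hα₀ : 0 ≤ α₀ := (hw 0).nonneg.1
  have hβ₀ : 0 ≤ β₀ := (hw 0).nonneg.2
  -- EL₁ of the base phases `e^{±θ₀,t}` from EL₁ of the base connection (`e^{θ₀} = 1 − V₀∕n`, `e^{−θ₀} = 1 − V̄₀∕n`)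
  have hE1 : ∀ k (ν' f : Fin d) (z : Fin d → ℤ), ∃ e : ℂ, Tendsto (fun t => Complex.exp (Complex.I * (A₀ t k ν' (castT (cubic d (lev L k * evenPeriod t)) z, f) : ℂ)
        / ((lev L k : ℕ) : ℂ))) atTop (𝓝 e) := by
    intro k ν' f z
    obtain ⟨s, hs⟩ := hw1 k ν' f z
    refine ⟨(1 : ℂ) + (-1 : ℂ) * (s / ((lev L k : ℕ) : ℂ)), (tendsto_const_nhds.add ((hs.div_const _).const_mul (-1 : ℂ))).congr fun t => ?_⟩
    exact (congrFun (congrFun (congrFun (basePhase_eq L (cubic d (evenPeriod t)) (A₀ t)) k) ν') (castT (cubic d (lev L k * evenPeriod t)) z, f)).symm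
  have hE2 : ∀ k (ν' f : Fin d) (z : Fin d → ℤ), ∃ e : ℂ, Tendsto (fun t => Complex.exp (-(Complex.I * (A₀ t k ν' (castT (cubic d (lev L k * evenPeriod t)) z, f) : ℂ)
        / ((lev L k : ℕ) : ℂ)))) atTop (𝓝 e) := by
    intro k ν' f z
    obtain ⟨s, hs⟩ := hw1 k ν' f z
    refine ⟨(1 : ℂ) + (-1 : ℂ) * (star s / ((lev L k : ℕ) : ℂ)), (tendsto_const_nhds.add ((hs.star.div_const _).const_mul (-1 : ℂ))).congr fun t => ?_⟩
    exact (congrFun (congrFun (congrFun (baseConjPhase_eq L (cubic d (evenPeriod t)) (A₀ t)) k) ν') (castT (cubic d (lev L k * evenPeriod t)) z, f)).symm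
  refine conv_iteratedDeriv_invCov_covariantCurveAt_of_tendsto L a ha hL hd hne ha' hκ0 hγ' hδ' hJA hT₁ hT₂ hT₃ N
    (α := max α₀ ((1 + α) ^ N * (1 + α₀))) (β := max β₀ ((1 + α) ^ N * (α₀ + β₀) + (1 + α) ^ N * ((N + 1) * β + 2) * (1 + α₀)))
    (α' := max α₀' (max (d * (α * (α₀ + α₀))) (d * ((1 + α) ^ N * α * (1 + α₀)) + d * ((1 + α) ^ N * α * (1 + α₀)))))
    (β' := max β₀' (max (d * (α * (β₀ + β₀) + β * (α₀ + α₀)))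
      (d * ((1 + α) ^ N * α * (α₀ + β₀) + ((1 + α) ^ N * β + (1 + α) ^ N * ((N + 1) * β + 2) * α) * (1 + α₀))
        + d * ((1 + α) ^ N * α * (α₀ + β₀) + ((1 + α) ^ N * β + (1 + α) ^ N * ((N + 1) * β + 2) * α) * (1 + α₀)))))
    (U := fun t s k ν' x => Complex.exp (Complex.I * (A₀ t k ν' x : ℂ) / ((lev L k : ℕ) : ℂ) + (Complex.I * (X t k ν' x : ℂ) / ((lev L k : ℕ) : ℂ)) * (s : ℂ)))
    (fun t k ν' x n => by rw [cexp_add_mul_eq]; exact contDiff_const.mul (contDiff_expChart_entry _ n))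
    (fun t => by simpa only [Complex.ofReal_zero, mul_zero, add_zero] using hw t) (fun t => by simpa only [Complex.ofReal_zero, mul_zero, add_zero] using hz t)
    ?_ ?_ ?_ ?_
  · -- the connection jets: `j = 0` the base connection, `j ≥ 1` §2
    intro j hj t
    rcases j with _ | i
    · have e : (fun k ν' (x : idx L (cubic d (evenPeriod t)) k) => iteratedDeriv 0 (fun s : ℝ => connV L (cubic d (evenPeriod t))
            (fun k'' ν'' x' => Complex.exp (Complex.I * (A₀ t k'' ν'' x' : ℂ) / ((lev L k'' : ℕ) : ℂ) + (Complex.I * (X t k'' ν'' x' : ℂ) / ((lev L k'' : ℕ) : ℂ)) * (s : ℂ))) k ν' x) 0)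
          = connV L (cubic d (evenPeriod t)) (fun k ν' (x : idx L (cubic d (evenPeriod t)) k) => Complex.exp (Complex.I * (A₀ t k ν' x : ℂ) / ((lev L k : ℕ) : ℂ))) := by
        funext k ν' x
        simp only [iteratedDeriv_zero, Complex.ofReal_zero, mul_zero, add_zero]
      rw [e]
      exact lipschitzBackground_mono L _ (hw t) (le_max_left _ _) (le_max_left _ _)
    · exact lipschitzBackground_mono L _ (lipschitzBackground_expChartAt_jetV_succ L _ (hX t) (hw t) hj) (le_max_right _ _) (le_max_right _ _)
  · -- the zeroth-order jets: `j = 0` the base field, `j = 1` and `j ≥ 2` §2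
    intro j hj t
    rcases j with _ | _ | i
    · have e : (fun k (x : idx L (cubic d (evenPeriod t)) k) => iteratedDeriv 0 (fun s : ℝ => zT L (cubic d (evenPeriod t))
            (fun k'' ν'' x' => Complex.exp (Complex.I * (A₀ t k'' ν'' x' : ℂ) / ((lev L k'' : ℕ) : ℂ) + (Complex.I * (X t k'' ν'' x' : ℂ) / ((lev L k'' : ℕ) : ℂ)) * (s : ℂ))) k x) 0)
          = zT L (cubic d (evenPeriod t)) (fun k ν' (x : idx L (cubic d (evenPeriod t)) k) => Complex.exp (Complex.I * (A₀ t k ν' x : ℂ) / ((lev L k : ℕ) : ℂ))) := by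
        funext k x
        simp only [iteratedDeriv_zero, Complex.ofReal_zero, mul_zero, add_zero]
      rw [e]
      exact boundedBackground_mono L _ (hz t) (le_max_left _ _) (le_max_left _ _)
    · exact boundedBackground_mono L _ (boundedBackground_expChartAt_jetZ_one L _ (hX t) (hw t))
        ((le_max_left _ _).trans (le_max_right _ _)) ((le_max_left _ _).trans (le_max_right _ _))
    · exact boundedBackground_mono L _ (boundedBackground_expChartAt_jetZ_succ_succ L _ (hX t) (hw t) hj)
        ((le_max_right _ _).trans (le_max_right _ _)) ((le_max_right _ _).trans (le_max_right _ _))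
  · -- EL₁ of the connection jets (PART 265's closed forms)
    intro j _ k ν' f z
    obtain ⟨sX, hsX⟩ := hX1 k ν' f z
    obtain ⟨e, he⟩ := hE1 k ν' f z
    refine ⟨if j = 0 then ((lev L k : ℕ) : ℂ) - ((lev L k : ℕ) : ℂ) * e
      else -(((lev L k : ℕ) : ℂ) * e * (Complex.I * sX / ((lev L k : ℕ) : ℂ)) ^ j), ?_⟩
    simp only [iteratedDeriv_connV_expChartAt]
    split_ifs
    · exact tendsto_const_nhds.sub (he.const_mul _)
    · exact ((he.const_mul _).mul (((hsX.const_mul Complex.I).div_const _).pow j)).neg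
  · -- EL₁ of the zeroth-order jets (PART 265's closed forms)
    intro j _ k f z
    choose sX hsX using fun (ν' : Fin d) => hX1 k ν' f z
    choose e he using fun (ν' : Fin d) => hE1 k ν' f z
    choose e' he' using fun (ν' : Fin d) => hE2 k ν' f z
    refine ⟨if j = 0 then -((lev L k : ℕ) : ℂ) ^ 2 * ∑ ν', (e ν' + e' ν' - 2)
      else -((lev L k : ℕ) : ℂ) ^ 2 * ∑ ν', (e ν' * (Complex.I * sX ν' / ((lev L k : ℕ) : ℂ)) ^ j + e' ν' * (-(Complex.I * sX ν' / ((lev L k : ℕ) : ℂ))) ^ j), ?_⟩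
    simp only [iteratedDeriv_zT_expChartAt]
    split_ifs
    · exact (tendsto_finsetSum _ fun ν' _ => ((he ν').add (he' ν')).sub tendsto_const_nhds).const_mul _
    · exact (tendsto_finsetSum _ fun ν' _ => ((he ν').mul ((((hsX ν').const_mul Complex.I).div_const _).pow j)).add
        ((he' ν').mul ((((hsX ν').const_mul Complex.I).div_const _).neg.pow j))).const_mul _

end End

end Summit.QuantumFields.BalabanUV.Beta.GAN24.ExponentialChartBaseCovariantTaylorLine

end
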